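import Literature.AlgebraicGeometry.HodgeTheory.HyperplaneSectionRationalMonodromy

/-!
# Route LinearSystemTorelli — crux `LocalTubeSpan` (stmt-HodgeConjecture-2490): existence of the rational monodromy (the `ℚ`-form of `Rᵏ π_* ℂ|_U` at a point)

Helper file (`--supports stmt-HodgeConjecture-2490`, line `Sketch` of the crux chain, cycle 5
"assembly on the tree's hyperplane-section package", stub `stub_ratForm`, taken by the lead).

The line reduces the crux ("local Schnell theorem", C. Schnell, *Primitive cohomology and the tube
mapping*, Math. Z. 268 (2010) §3, §7) to cyclic detection for monodromy representations and proves
it over `ℚ`.  The tree's hyperplane-section package `DirectImageLocalSystem π n`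
(`Literature/AlgebraicGeometry/HodgeTheory/HyperplaneSectionLocalSystem`) is over `ℂ`; cycle 4's
base-change theorem (`localTubeSpan_injective_evalCoinv_iff_of_tensorEquiv`, file `…BaseChange`)
moves cyclic detection from a finite-dimensional `ℚ`-form.  The `ℚ`-form on the tree's real objects
is the rational monodromy `DirectImageLocalSystem.ratMonodromy D k s` (Literature file
`HodgeTheory/HyperplaneSectionRationalMonodromy`, landed in this cycle); this file records the
registered stub statement:

* `localTubeSpan_exists_ratForm` — there is a representation `ρ` of `π₁(U, s)` on `Hᵏ(X_s(ℂ); ℚ)`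
  with `ofRatClass (ρ γ a) = D.monodromyBetti k s γ (ofRatClass a)` (witness: `ratMonodromy`,
  property `ofRatClass_ratMonodromy`).

The companion `localTubeSpan_ratTensorEquiv` (file `…RatTensorEquiv`) shows that any such `ρ` is a
finite-dimensional `ℚ`-form of `monodromyRepObj (D.V k) s`.  No named facts, no `sorry`.
-/

-- `Summit.HodgeConjecture.HodgeConjecture.Theorems` is the mandated namespace (single-conjunct summit:
-- Sub = Summit), which `linter.dupNamespace` flags on every declaration; the lakefile turns the
-- linter off tree-wide (weak option), restated here so stand-alone elaboration is warning-free too.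
set_option linter.dupNamespace false

noncomputable section

open CategoryTheory AlgebraicGeometry
open Literature.AlgebraicGeometry Literature.AlgebraicGeometry.HodgeTheory
open Literature.AlgebraicTopology.SingularHomology

namespace Summit.HodgeConjecture.HodgeConjecture.Theorems

variable {𝒳 Sb : Motives.SchemeOver ℂ} {π : 𝒳 ⟶ Sb} {n : ℕ}

/-- **Existence of the rational monodromy** (stub `stub_ratForm` of the line `Sketch`): there is a
representation `ρ` of `π₁(U, s)` on `Hᵏ(X_s(ℂ); ℚ)` with `ofRatClass (ρ γ a) = monodromyBetti γ
(ofRatClass a)` — the `ℚ`-form of the monodromy representation of `Rᵏ π_* ℂ|_U` at `s`, namely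
`DirectImageLocalSystem.ratMonodromy` (unique by `ratMonodromy_unique`). [cite: VoisinHodgeII2003, §3.2.2 and Def. 3.13] -/
theorem localTubeSpan_exists_ratForm (D : DirectImageLocalSystem π n) (k : ℕ)
    (s : smoothFiberLocus π n) :
    ∃ ρ : Representation ℚ (FundamentalGroup (smoothFiberLocus π n) s)
        (Motives.bettiCohomology (Motives.fiberOver π s.1) k),
      ∀ (g : FundamentalGroup (smoothFiberLocus π n) s)
        (x : Motives.bettiCohomology (Motives.fiberOver π s.1) k),
        ofRatClass (Motives.ComplexPoints (Motives.fiberOver π s.1)) k (ρ g x) =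
          D.monodromyBetti k s g (ofRatClass (Motives.ComplexPoints (Motives.fiberOver π s.1)) k x) :=
  ⟨D.ratMonodromy k s, D.ofRatClass_ratMonodromy k s⟩

end Summit.HodgeConjecture.HodgeConjecture.Theorems

end
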